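/-
Copyright (c) 2026 the pub-hodgecm-mathlib formalisation cell (harness21).  Prover seat hodgecm-mathlib-R90-CS-p03 (g4), Track B ∕ R90-TF, h413 = `stmt-HodgeConjecture-24833`,
R90-TF section S8 «ContSpec-n½» (S8 dealer R90-CS-plan (g4) S8-R275 (1) W9 «WILD-RESIDUE CONSOLIDATION»; census `R90/S8/CENSUS-W9-WildResidue.R90-CS-p03-g4.md` 33ab1279cc616f40):
the letter `hW1 : resGMidBlock ≤ resGMidBlockτ` of (R)′ ∕ (M) ∕ (V♭) is ★ modulo ONE named letter (hLB) «every pointwise continuation of the Eisenstein family of a continuous section is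
locally bounded» — both wild residues of the hW1 road ((hreg) of ★ p865265, (hKwildLB) of ★ p865202) die to it.
-/
import Summits.HodgeConjecture.HodgeConjecture.Theorems.R90S8ResGMidAtomLocallyBoundedDataOfTauLevelU3   -- ★ p865244 (this seat); brings ★ p865202 `hW1_of_locallyBounded`, `continuous_midContinuation_apply_of_locallyBounded`, ★ p865108, ★ p865018
import Summits.HodgeConjecture.HodgeConjecture.Theorems.R90S8ResGMidAtomGenKTypeProjectionClassU3     -- ★ p865243 (LH4-p10 (g9)): `hKreg_of_regular` ((hKreg) letter-free for regular data)
import Summits.HodgeConjecture.HodgeConjecture.Theorems.R90S8ResGMidAtomAveragedDatumOfRegularU3       -- ★ p865265 (K2E1-p14 (g5)): `hFIN_of_regular_haar` ((hFIN) from regular level-free data)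
import HarnessLib

/-!
# S8 (R)′ ∕ (M) ∕ (V♭) letter `hW1` — `R90S8ResGMidWildResidueOfLocallyBoundedContinuationU3` (W9): `hW1` IS ★ MODULO ONE NAMED LETTER (hLB), «every pointwise continuation is locally bounded»

Track B ∕ R90-TF, crux h413 = `stmt-HodgeConjecture-24833`, route of record `HCCMUnconditional`; cell `hodgecm-mathlib`, R90-TF section S8 «ContSpec-n½», letter `hW1 : resGMidBlock ξ μω ≤
resGMidBlockτ ξ μω` of (R)′ :337 ∕ (M) :299 ∕ (V♭) :406; ruling J-S8-hW1.  THEOREMS ONLY (no `def`, no `instance`, no `notation`, no named-fact hypothesis, no `sorry`; default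
heartbeats); lane `--supports stmt-HodgeConjecture-24833 --as helper` (count-neutral).  CLOSES NO SOCKET.

THE CONSOLIDATION (census 33ab1279cc616f40).  The `K_∞`-type road pays `hW1` as ★ `hW1_of_locallyBounded (hμu) (hFIN) (hKwildLB) (hKreg)` (p865202) with: (hKreg) = ★ `hKreg_of_regular`
(LH4-p10 (g9), p865243: the `K_∞`-type cut of the class of a REGULAR τ-level datum is a τ-admissible generator); (hFIN) = ★ `hFIN_of_regular_haar (hμu) (hreg)` (K2E1-p14 (g5), p865265:
finite-adelic smoothing) modulo (hreg) «every level-free generator admits a REGULAR datum (`hE4 ∧ hEbd`)»; (hKwildLB) «every τ-level atom is the closed span of the classes of its LOCALLY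
BOUNDED data».  Since `hE4` (g-continuity) follows from `hEbd` (★ `continuous_midContinuation_apply_of_locallyBounded`, p865202), BOTH residues follow from the single letter
**(hLB)**: for every continuous level-free section `φ ∈ V(ξ.bcη⁻¹·ξ.bcψ⁻¹·μω, ξ.ψ; ⊥, 1)` and every pointwise continuation `(Ec, Sp)` of its Eisenstein family with ★ D1's clauses (`Sp` real in
`(1, 2]`, `Ec` holomorphic on `{1 < Re} ∖ Sp` pointwise in `g`, `= E(flat(φ, ·))` on `{2 < Re}`), `Ec` is JOINTLY LOCALLY BOUNDED on `({1 < Re} ∖ Sp) × S` for every compact `S` (ESTATE T's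
`hEbd` bytes).  Level `(⊥, 1)` suffices: every datum of level `(K′, ω)` is one of level `(⊥, 1)` (★ `chiSectionSpacePair_le_bot`).  Under (hLB) each datum IS regular, so ★ LH4 ∕ ★ p14 act
on the generator's OWN class — no approximants, no identification of limits, no continuity of the class map.  The head is MEASURE-FREE and FRAME-FREE: the Borel structures on `G(𝔸)`,
`G_f`, `K_∞ = U(J₃)(L⁺⊗ℝ) ∩ U(1⊗1)` and the Haar probability measure of the compact `K_∞` (★ `compactSpace_arch_inf_unitaryOne`, Mathlib `haarMeasure ⊤`) are built inside the proof.
(hLB) is printed for `K`-finite ∕ smooth sections ([MoeglinWaldspurger1995] II.1.5, IV.1.9–IV.1.11) and UNPRINTED for merely continuous ones — L, unowned; it is not a restatement of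
`hW1` (regularity of continuations vs closure of residue classes), and by ★ p865202 it is the exact obstruction of the road.
* §1 `hreg_of_locallyBoundedContinuation (hμu) (hLB)` — ★ `hFIN_of_regular_haar`'s `hreg` BYTE FOR BYTE.
* §2 `hKwildLB_of_locallyBoundedContinuation (hLB)` — ★ `hW1_of_locallyBounded`'s `hKwildLB` BYTE FOR BYTE.
* §3 HEAD **`hW1_of_locallyBoundedContinuation (hμu) (hLB) : resGMidBlock L μ ξ μω ≤ resGMidBlockτ L μ ξ μω`**, `resGMidBlockτ_eq_resGMidBlock_of_locallyBoundedContinuation`.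
HONEST LABEL: HC_CM is proved only modulo the 7 printed citations (2 remaining named inputs: hLiu418 = `stmt-HodgeConjecture-24832`, h413 = `stmt-HodgeConjecture-24833`) until
rung 0 closes; REL ≠ ★ ≠ BUILT; this file PAYS NO SOCKET: `hW1` = ★ ∘ {(hLB) — L, UNOWNED, unprinted for continuous sections}; count-neutral.

## References
* [MoeglinWaldspurger1995] C. Mœglin, J.-L. Waldspurger, *Spectral Decomposition and Eisenstein Series* (1995), I.2.17, II.1.5, IV.1.9–IV.1.11, V.3.13.
* [BrockerTomDieck1985] T. Bröcker, T. tom Dieck, *Representations of Compact Lie Groups*, GTM 98 (1985), III Thm. (5.10).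
* [Rogawski1990] J. D. Rogawski, *Automorphic Representations of Unitary Groups in Three Variables* (1990), §13.9 p. 229 (ii).
-/

set_option autoImplicit false
set_option linter.dupNamespace false  -- the mandated namespace `…HodgeConjecture.HodgeConjecture.R90.S8` (LEAD #1 L1) repeats the summit's segment

noncomputable section

open MeasureTheory Measure Set Filter Topology NumberField ContRepresentation
open Literature.NumberTheory Literature.NumberTheory.Automorphic Literature.NumberTheory.Automorphic.UnitaryGroup Literature.NumberTheory.GaloisRepresentations AdelicGroupData
open Literature.NumberTheory.Automorphic.Arthur2013.Leaves.TECR Literature.NumberTheory.Rogawski1990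
open Literature.RepresentationTheory.CompactGroups
open Summit.HodgeConjecture.HodgeConjecture.Cruxes.H413.K2E1BorelEisensteinU
open Summit.HodgeConjecture.HodgeConjecture.Cruxes.H413.K2E1ChiSectionSpaceU3PairDefs
open scoped ENNReal NNReal InnerProductSpace

namespace Summit.HodgeConjecture.HodgeConjecture.R90.S8

variable (L : Type) [Field L] [NumberField L] [IsCMField L]
  (μ : Measure (quasiSplit (↥(maximalRealSubfield L)) L (IsCMField.complexConj L) 3).automorphicQuotient)
  (ξ : OneDimAutRepH L) {μω : HeckeCharacter L}

/-! ## §1 (hreg) of ★ `hFIN_of_regular_haar` from (hLB): every level-free datum is regular -/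

/-- **(hreg) FROM (hLB)**: under (hLB) every level-free D1 generator admits a REGULAR datum — its own, with `hEbd` := (hLB) and `hE4` := ★ `continuous_midContinuation_apply_of_locallyBounded`.
Conclusion = ★ `hFIN_of_regular_haar`'s binder `hreg` BYTE FOR BYTE. [cite: MoeglinWaldspurger1995, II.1.5, IV.1.9–IV.1.11] -/
theorem hreg_of_locallyBoundedContinuation (hμω : μω.IsUnitary)
    (hLB : ∀ (φ : (quasiSplit (↥(maximalRealSubfield L)) L (IsCMField.complexConj L) 3).Adelic → ℂ)
      (_ : φ ∈ chiSectionSpacePair (ξ.bcη⁻¹ * ξ.bcψ⁻¹ * μω) ξ.ψ (⊥ : Subgroup (quasiSplit (↥(maximalRealSubfield L)) L (IsCMField.complexConj L) 3).Adelic)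
        ((1 : ↥(⊥ : Subgroup (quasiSplit (↥(maximalRealSubfield L)) L (IsCMField.complexConj L) 3).Adelic) →* ℂ) :
          ↥(⊥ : Subgroup (quasiSplit (↥(maximalRealSubfield L)) L (IsCMField.complexConj L) 3).Adelic) → ℂ)) (_ : Continuous φ)
      (Ec : ℂ → (quasiSplit (↥(maximalRealSubfield L)) L (IsCMField.complexConj L) 3).Adelic → ℂ) (Sp : Finset ℂ)
      (_ : ∀ s ∈ Sp, s.im = 0 ∧ 1 < s.re ∧ s.re ≤ 2)
      (_ : ∀ g, DifferentiableOn ℂ (fun z => Ec z g) ({z : ℂ | 1 < z.re} \ (↑Sp : Set ℂ)))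
      (_ : ∀ z : ℂ, 2 < z.re → Ec z = eisensteinSeriesU (flatSectionU φ z)),
      ∀ z₁ ∈ ({z : ℂ | 1 < z.re} \ (↑Sp : Set ℂ)), ∀ S : Set (quasiSplit (↥(maximalRealSubfield L)) L (IsCMField.complexConj L) 3).Adelic, IsCompact S →
        ∃ V ∈ 𝓝 z₁, ∃ M : ℝ, ∀ z ∈ V, ∀ g ∈ S, ‖Ec z g‖ ≤ M) :
    ∀ f ∈ resGMidAtomGen L μ ξ μω ⊥ 1,
      ∃ (φ : (quasiSplit (↥(maximalRealSubfield L)) L (IsCMField.complexConj L) 3).Adelic → ℂ)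
        (_ : φ ∈ chiSectionSpacePair (ξ.bcη⁻¹ * ξ.bcψ⁻¹ * μω) ξ.ψ (⊥ : Subgroup (quasiSplit (↥(maximalRealSubfield L)) L (IsCMField.complexConj L) 3).Adelic)
          ((1 : ↥(⊥ : Subgroup (quasiSplit (↥(maximalRealSubfield L)) L (IsCMField.complexConj L) 3).Adelic) →* ℂ) :
            ↥(⊥ : Subgroup (quasiSplit (↥(maximalRealSubfield L)) L (IsCMField.complexConj L) 3).Adelic) → ℂ)) (_ : Continuous φ)
        (Ec : ℂ → (quasiSplit (↥(maximalRealSubfield L)) L (IsCMField.complexConj L) 3).Adelic → ℂ) (Sp : Finset ℂ)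
        (_ : ∀ s ∈ Sp, s.im = 0 ∧ 1 < s.re ∧ s.re ≤ 2)
        (_ : ∀ g, DifferentiableOn ℂ (fun z => Ec z g) ({z : ℂ | 1 < z.re} \ (↑Sp : Set ℂ)))
        (_ : ∀ z ∈ ({z : ℂ | 1 < z.re} \ (↑Sp : Set ℂ)), Continuous (Ec z))
        (_ : ∀ z₁ ∈ ({z : ℂ | 1 < z.re} \ (↑Sp : Set ℂ)), ∀ S : Set (quasiSplit (↥(maximalRealSubfield L)) L (IsCMField.complexConj L) 3).Adelic, IsCompact S →
          ∃ V ∈ 𝓝 z₁, ∃ M : ℝ, ∀ z ∈ V, ∀ g ∈ S, ‖Ec z g‖ ≤ M)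
        (_ : ∀ z : ℂ, 2 < z.re → Ec z = eisensteinSeriesU (flatSectionU φ z))
        (Fp : (quasiSplit (↥(maximalRealSubfield L)) L (IsCMField.complexConj L) 3).Adelic → ℂ → ℂ)
        (_ : ∀ g, AnalyticAt ℂ (Fp g) ((3 : ℂ) / 2))
        (_ : ∀ g, Fp g =ᶠ[𝓝[≠] ((3 : ℂ) / 2)] fun z => (z - (3 : ℂ) / 2) * Ec z g),
        (f : (quasiSplit (↥(maximalRealSubfield L)) L (IsCMField.complexConj L) 3).automorphicQuotient → ℂ) =ᵐ[μ]
          fun x => Fp (Quotient.out (x : (quasiSplit (↥(maximalRealSubfield L)) L (IsCMField.complexConj L) 3).Adelic ⧸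
            (quasiSplit (↥(maximalRealSubfield L)) L (IsCMField.complexConj L) 3).quotientSubgroup))⁻¹ ((3 : ℂ) / 2) := by
  rintro f ⟨φ, hφV, hφc, Ec, Sp, hSp, hol, hEc2, Fp, hFp, hFpE, hae⟩
  have hEbd := hLB φ hφV hφc Ec Sp hSp hol hEc2
  exact ⟨φ, hφV, hφc, Ec, Sp, hSp, hol, continuous_midContinuation_apply_of_locallyBounded L ξ hμω hφV hφc Ec Sp (fun s hs => (hSp s hs).1) hol hEbd hEc2, hEbd, hEc2, Fp, hFp, hFpE, hae⟩

/-! ## §2 (hKwildLB) of ★ `hW1_of_locallyBounded` from (hLB): every τ-level generator's own datum is locally bounded -/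

/-- **(hKwildLB) FROM (hLB)**: under (hLB) every τ-level generator IS the class of a locally bounded datum (its own; a datum of level `ι_f U₀` is one of level `⊥`, ★ `chiSectionSpacePair_le_bot`),
so every τ-level atom — the closed span of its generators — lies in the closed span of the locally bounded classes.  Conclusion = ★ `hW1_of_locallyBounded`'s binder `hKwildLB` BYTE FOR BYTE.
[cite: MoeglinWaldspurger1995, IV.1.11, V.3.13] -/
theorem hKwildLB_of_locallyBoundedContinuation
    (hLB : ∀ (φ : (quasiSplit (↥(maximalRealSubfield L)) L (IsCMField.complexConj L) 3).Adelic → ℂ)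
      (_ : φ ∈ chiSectionSpacePair (ξ.bcη⁻¹ * ξ.bcψ⁻¹ * μω) ξ.ψ (⊥ : Subgroup (quasiSplit (↥(maximalRealSubfield L)) L (IsCMField.complexConj L) 3).Adelic)
        ((1 : ↥(⊥ : Subgroup (quasiSplit (↥(maximalRealSubfield L)) L (IsCMField.complexConj L) 3).Adelic) →* ℂ) :
          ↥(⊥ : Subgroup (quasiSplit (↥(maximalRealSubfield L)) L (IsCMField.complexConj L) 3).Adelic) → ℂ)) (_ : Continuous φ)
      (Ec : ℂ → (quasiSplit (↥(maximalRealSubfield L)) L (IsCMField.complexConj L) 3).Adelic → ℂ) (Sp : Finset ℂ)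
      (_ : ∀ s ∈ Sp, s.im = 0 ∧ 1 < s.re ∧ s.re ≤ 2)
      (_ : ∀ g, DifferentiableOn ℂ (fun z => Ec z g) ({z : ℂ | 1 < z.re} \ (↑Sp : Set ℂ)))
      (_ : ∀ z : ℂ, 2 < z.re → Ec z = eisensteinSeriesU (flatSectionU φ z)),
      ∀ z₁ ∈ ({z : ℂ | 1 < z.re} \ (↑Sp : Set ℂ)), ∀ S : Set (quasiSplit (↥(maximalRealSubfield L)) L (IsCMField.complexConj L) 3).Adelic, IsCompact S →
        ∃ V ∈ 𝓝 z₁, ∃ M : ℝ, ∀ z ∈ V, ∀ g ∈ S, ‖Ec z g‖ ≤ M) :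
    ∀ (U₀ : Subgroup ↥(finAdelic (↥(maximalRealSubfield L)) L (IsCMField.complexConj L) 3 ((StdForm.antidiagonal 3).over L))) (_ : IsTauLevel L U₀),
      resGMidAtom L μ ξ μω (tauLevel L U₀) 1 ≤
        (Submodule.span ℂ {f : (quasiSplit (↥(maximalRealSubfield L)) L (IsCMField.complexConj L) 3).L2 μ |
          ∃ (φ : (quasiSplit (↥(maximalRealSubfield L)) L (IsCMField.complexConj L) 3).Adelic → ℂ)
            (_ : φ ∈ chiSectionSpacePair (ξ.bcη⁻¹ * ξ.bcψ⁻¹ * μω) ξ.ψ (tauLevel L U₀) ((1 : ↥(tauLevel L U₀) →* ℂ) : ↥(tauLevel L U₀) → ℂ)) (_ : Continuous φ)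
            (Ec : ℂ → (quasiSplit (↥(maximalRealSubfield L)) L (IsCMField.complexConj L) 3).Adelic → ℂ) (Sp : Finset ℂ)
            (_ : ∀ s ∈ Sp, s.im = 0 ∧ 1 < s.re ∧ s.re ≤ 2)
            (_ : ∀ g, DifferentiableOn ℂ (fun z => Ec z g) ({z : ℂ | 1 < z.re} \ (↑Sp : Set ℂ)))
            (_ : ∀ z₁ ∈ ({z : ℂ | 1 < z.re} \ (↑Sp : Set ℂ)), ∀ S : Set (quasiSplit (↥(maximalRealSubfield L)) L (IsCMField.complexConj L) 3).Adelic, IsCompact S → ∃ V ∈ 𝓝 z₁, ∃ M : ℝ, ∀ z ∈ V, ∀ g ∈ S, ‖Ec z g‖ ≤ M)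
            (_ : ∀ z : ℂ, 2 < z.re → Ec z = eisensteinSeriesU (flatSectionU φ z))
            (Fp : (quasiSplit (↥(maximalRealSubfield L)) L (IsCMField.complexConj L) 3).Adelic → ℂ → ℂ)
            (_ : ∀ g, AnalyticAt ℂ (Fp g) ((3 : ℂ) / 2))
            (_ : ∀ g, Fp g =ᶠ[𝓝[≠] ((3 : ℂ) / 2)] fun z => (z - (3 : ℂ) / 2) * Ec z g),
            (f : (quasiSplit (↥(maximalRealSubfield L)) L (IsCMField.complexConj L) 3).automorphicQuotient → ℂ) =ᵐ[μ]
              fun x => Fp (Quotient.out (x : (quasiSplit (↥(maximalRealSubfield L)) L (IsCMField.complexConj L) 3).Adelic ⧸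
                (quasiSplit (↥(maximalRealSubfield L)) L (IsCMField.complexConj L) 3).quotientSubgroup))⁻¹ ((3 : ℂ) / 2)}).topologicalClosure := by
  intro U₀ _
  rw [resGMidAtom_def]
  refine Submodule.topologicalClosure_mono (Submodule.span_mono ?_)
  rintro f ⟨φ, hφV, hφc, Ec, Sp, hSp, hol, hEc2, Fp, hFp, hFpE, hae⟩
  exact ⟨φ, hφV, hφc, Ec, Sp, hSp, hol, hLB φ (chiSectionSpacePair_le_bot L (tauLevel L U₀) 1 hφV) hφc Ec Sp hSp hol hEc2, hEc2, Fp, hFp, hFpE, hae⟩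

/-! ## §3 HEAD: `hW1` modulo the single letter (hLB) -/

variable [(quasiSplit (↥(maximalRealSubfield L)) L (IsCMField.complexConj L) 3).IsAutomorphicMeasure μ]

/-- **HEAD — `hW1` OF (R)′ ∕ (M) ∕ (V♭) IS ★ MODULO ONE NAMED LETTER (hLB)**: `resGMidBlock L μ ξ μω ≤ resGMidBlockτ L μ ξ μω` from `μω` unitary and (hLB) «every pointwise continuation `Ec` of the
Eisenstein family of a continuous level-free section is jointly locally bounded on `({1<Re}∖Sp) × compacts`» (L, unowned; printed for `K`-finite ∕ smooth sections).  Assembly: ★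
`hW1_of_locallyBounded` (p865202) with (hFIN) := ★ `hFIN_of_regular_haar` (K2E1-p14, p865265) ∘ §1, (hKwildLB) := §2, (hKreg) := ★ `hKreg_of_regular` (LH4-p10, p865243); the Borel
structures on `G(𝔸)`, `G_f`, `K_∞` and the Haar probability measure of the compact `K_∞` are CHOSEN HERE (no frame binder).  Bind: ★ `res_midBlock_le_residual_of_tauAdmissible
(hW1 := hW1_of_locallyBoundedContinuation L μ ξ hμu hLB) …`, ★ p865014 ∕ p864870 `(hW1 := …)`. [cite: MoeglinWaldspurger1995, I.2.17, II.1.5, IV.1.11, V.3.13]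
[cite: BrockerTomDieck1985, III Thm (5.10)] [cite: Rogawski1990, §13.9 p. 229 (ii)] -/
theorem hW1_of_locallyBoundedContinuation (hμω : μω.IsUnitary)
    (hLB : ∀ (φ : (quasiSplit (↥(maximalRealSubfield L)) L (IsCMField.complexConj L) 3).Adelic → ℂ)
      (_ : φ ∈ chiSectionSpacePair (ξ.bcη⁻¹ * ξ.bcψ⁻¹ * μω) ξ.ψ (⊥ : Subgroup (quasiSplit (↥(maximalRealSubfield L)) L (IsCMField.complexConj L) 3).Adelic)
        ((1 : ↥(⊥ : Subgroup (quasiSplit (↥(maximalRealSubfield L)) L (IsCMField.complexConj L) 3).Adelic) →* ℂ) :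
          ↥(⊥ : Subgroup (quasiSplit (↥(maximalRealSubfield L)) L (IsCMField.complexConj L) 3).Adelic) → ℂ)) (_ : Continuous φ)
      (Ec : ℂ → (quasiSplit (↥(maximalRealSubfield L)) L (IsCMField.complexConj L) 3).Adelic → ℂ) (Sp : Finset ℂ)
      (_ : ∀ s ∈ Sp, s.im = 0 ∧ 1 < s.re ∧ s.re ≤ 2)
      (_ : ∀ g, DifferentiableOn ℂ (fun z => Ec z g) ({z : ℂ | 1 < z.re} \ (↑Sp : Set ℂ)))
      (_ : ∀ z : ℂ, 2 < z.re → Ec z = eisensteinSeriesU (flatSectionU φ z)),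
      ∀ z₁ ∈ ({z : ℂ | 1 < z.re} \ (↑Sp : Set ℂ)), ∀ S : Set (quasiSplit (↥(maximalRealSubfield L)) L (IsCMField.complexConj L) 3).Adelic, IsCompact S →
        ∃ V ∈ 𝓝 z₁, ∃ M : ℝ, ∀ z ∈ V, ∀ g ∈ S, ‖Ec z g‖ ≤ M) :
    resGMidBlock L μ ξ μω ≤ resGMidBlockτ L μ ξ μω := by
  -- Borel structures on `G(𝔸)`, `G_f`, `K_∞` (chosen here; the statement mentions none)
  letI : MeasurableSpace (quasiSplit (↥(maximalRealSubfield L)) L (IsCMField.complexConj L) 3).Adelic := borel _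
  haveI : BorelSpace (quasiSplit (↥(maximalRealSubfield L)) L (IsCMField.complexConj L) 3).Adelic := ⟨rfl⟩
  letI : MeasurableSpace ↥(finAdelic (↥(maximalRealSubfield L)) L (IsCMField.complexConj L) 3 ((StdForm.antidiagonal 3).over L)) := borel _
  haveI : BorelSpace ↥(finAdelic (↥(maximalRealSubfield L)) L (IsCMField.complexConj L) 3 ((StdForm.antidiagonal 3).over L)) := ⟨rfl⟩
  letI : MeasurableSpace ↥(UnitaryGroup.arch (↥(maximalRealSubfield L)) L (IsCMField.complexConj L) 3 ((StdForm.antidiagonal 3).over L) ⊓ unitaryGroupOfForm (conjMixed (↥(maximalRealSubfield L)) L (IsCMField.complexConj L)) 1) := borel _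
  haveI : BorelSpace ↥(UnitaryGroup.arch (↥(maximalRealSubfield L)) L (IsCMField.complexConj L) 3 ((StdForm.antidiagonal 3).over L) ⊓ unitaryGroupOfForm (conjMixed (↥(maximalRealSubfield L)) L (IsCMField.complexConj L)) 1) := ⟨rfl⟩
  -- `K_∞` is second countable (a subgroup of `GL₃(L ⊗ ℝ)`) and compact (★); its Haar probability measure
  haveI : SecondCountableTopology (Matrix (Fin 3) (Fin 3) (NumberField.mixedEmbedding.mixedSpace L)) :=
    inferInstanceAs (SecondCountableTopology (Fin 3 → Fin 3 → NumberField.mixedEmbedding.mixedSpace L))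
  haveI : SecondCountableTopology (Matrix (Fin 3) (Fin 3) (NumberField.mixedEmbedding.mixedSpace L))ᵐᵒᵖ := MulOpposite.opHomeomorph.symm.secondCountableTopology
  haveI : SecondCountableTopology (GL (Fin 3) (NumberField.mixedEmbedding.mixedSpace L)) := Units.isEmbedding_embedProduct.secondCountableTopology
  haveI : SecondCountableTopology ↥(UnitaryGroup.arch (↥(maximalRealSubfield L)) L (IsCMField.complexConj L) 3 ((StdForm.antidiagonal 3).over L) ⊓ unitaryGroupOfForm (conjMixed (↥(maximalRealSubfield L)) L (IsCMField.complexConj L)) 1) :=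
    TopologicalSpace.Subtype.secondCountableTopology _
  haveI : CompactSpace ↥(UnitaryGroup.arch (↥(maximalRealSubfield L)) L (IsCMField.complexConj L) 3 ((StdForm.antidiagonal 3).over L) ⊓ unitaryGroupOfForm (conjMixed (↥(maximalRealSubfield L)) L (IsCMField.complexConj L)) 1) :=
    compactSpace_arch_inf_unitaryOne L 3 ((StdForm.antidiagonal 3).over L)
  haveI : IsProbabilityMeasure (Measure.haarMeasure (⊤ : TopologicalSpace.PositiveCompacts ↥(UnitaryGroup.arch (↥(maximalRealSubfield L)) L (IsCMField.complexConj L) 3 ((StdForm.antidiagonal 3).over L) ⊓ unitaryGroupOfForm (conjMixed (↥(maximalRealSubfield L)) L (IsCMField.complexConj L)) 1))) :=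
    ⟨by rw [← TopologicalSpace.PositiveCompacts.coe_top]; exact Measure.haarMeasure_self⟩
  exact hW1_of_locallyBounded L μ ξ (Measure.haarMeasure ⊤) hμω
    (hFIN_of_regular_haar L μ ξ μω hμω (hreg_of_locallyBoundedContinuation L μ ξ hμω hLB))
    (hKwildLB_of_locallyBoundedContinuation L μ ξ hLB)
    (hKreg_of_regular L μ ξ μω (Measure.haarMeasure ⊤) hμω)

/-- **Under (hLB) the τ-admissible and the full middle blocks COINCIDE** (★ `resGMidBlockτ_le_resGMidBlock` + the head). [cite: MoeglinWaldspurger1995, II.1, V.3.13] -/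
theorem resGMidBlockτ_eq_resGMidBlock_of_locallyBoundedContinuation (hμω : μω.IsUnitary)
    (hLB : ∀ (φ : (quasiSplit (↥(maximalRealSubfield L)) L (IsCMField.complexConj L) 3).Adelic → ℂ)
      (_ : φ ∈ chiSectionSpacePair (ξ.bcη⁻¹ * ξ.bcψ⁻¹ * μω) ξ.ψ (⊥ : Subgroup (quasiSplit (↥(maximalRealSubfield L)) L (IsCMField.complexConj L) 3).Adelic)
        ((1 : ↥(⊥ : Subgroup (quasiSplit (↥(maximalRealSubfield L)) L (IsCMField.complexConj L) 3).Adelic) →* ℂ) :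
          ↥(⊥ : Subgroup (quasiSplit (↥(maximalRealSubfield L)) L (IsCMField.complexConj L) 3).Adelic) → ℂ)) (_ : Continuous φ)
      (Ec : ℂ → (quasiSplit (↥(maximalRealSubfield L)) L (IsCMField.complexConj L) 3).Adelic → ℂ) (Sp : Finset ℂ)
      (_ : ∀ s ∈ Sp, s.im = 0 ∧ 1 < s.re ∧ s.re ≤ 2)
      (_ : ∀ g, DifferentiableOn ℂ (fun z => Ec z g) ({z : ℂ | 1 < z.re} \ (↑Sp : Set ℂ)))
      (_ : ∀ z : ℂ, 2 < z.re → Ec z = eisensteinSeriesU (flatSectionU φ z)),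
      ∀ z₁ ∈ ({z : ℂ | 1 < z.re} \ (↑Sp : Set ℂ)), ∀ S : Set (quasiSplit (↥(maximalRealSubfield L)) L (IsCMField.complexConj L) 3).Adelic, IsCompact S →
        ∃ V ∈ 𝓝 z₁, ∃ M : ℝ, ∀ z ∈ V, ∀ g ∈ S, ‖Ec z g‖ ≤ M) :
    resGMidBlockτ L μ ξ μω = resGMidBlock L μ ξ μω :=
  le_antisymm (resGMidBlockτ_le_resGMidBlock L μ ξ μω) (hW1_of_locallyBoundedContinuation L μ ξ hμω hLB)

end Summit.HodgeConjecture.HodgeConjecture.R90.S8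

end
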